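import Summits.Ventures.LatticeQCDFlow.Scaling.IdealStarAugmentation
import Summits.Ventures.LatticeQCDFlow.Scaling.HomLadderOneLevelModes

/-!
HONEST FRAMING: exact (Metropolis-corrected) sampling algorithms for lattice gauge theory; figures
of merit are autocorrelation/cost numbers at stated couplings and volumes; no continuum-physics
claim.

# GraphSchemeOneLevelModes — ONE-LEVEL STATISTICS OF A HOMOGENEOUS EXCHANGE SCHEME ON ANY SWAP LIST: `P = t·GSw_e + (1−t)·Upd_w` (ONE LAW `ν`, IDENTITY MAPS, EXACT HOT REDRAW, IDLE COLD
# KERNELS) MOVES `Φ(x) = Σ_kc_k·a(x_k)` BY `I − (t/m)·L_G − h·e_0e_0ᵀ` (`L_G` THE LAPLACIAN OF THE SWAP MULTIGRAPH, `h = (1−t)w_0`); A VECTOR SOLVING THE VERTEX EQUATIONS GIVES AN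
# EXACT EIGENFUNCTION `PΦ = (1−ρ)Φ`; WILSON INCREMENTS `≤ tΔ + h·c_0²` (lean-2 GEN-47, ours)

Venture-side (OURS).  Cell `lqcd-flow` (pub-lqcd), unit `pub-lqcd-lean-2-g47`, 2026-08-31.  Chapter AH (the hub–ladder interpolation), file 1 — groundwork for the successor: chapter AG
(the path, files 1–13) and chapters L ∕ AE (the star) are the two typed ends of one mechanism.  Setting: a swap LIST `e : Fin m → (levels)²` with distinct endpoints (multi-edges encode any
rational proposal law, chapter K), identity maps, ONE positive law `ν` at every level, the weighted scheme `P = t·ptGraphSwap ν^{⊗} e 1 + (1−t)·prodKernel w M` with the EXACT hot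
sampler and IDLE cold kernels (hypothesis-equation `hP`).  Every swap is accepted; a one-level sum `Φ = Σ_kc_k·a(x_k)` with `a` centred for `ν` moves IN EXPECTATION by the symmetric
matrix `Q = I − (t/m)L_G − (1−t)w_0·e_0e_0ᵀ`: an edge `(i,l)` contributes `(c_i − c_l)(a(x_l) − a(x_i))`.  If `c : levels → ℝ` solves the VERTEX EQUATIONS
`(t/m)Σ_r[1{k=i_r}(c_{l_r} − c_{i_r}) + 1{k=l_r}(c_{i_r} − c_{l_r})] − 1{k=0}(1−t)w_0c_0 = −ρc_k` (i.e. `Qc = (1−ρ)c`), then `PΦ = (1−ρ)Φ` EXACTLY and chapter AF file 1 (Wilson's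
lemma) applies with increments `≤ tΔ + (1−t)w_0c_0²`, `Δ ≥ (c_{i_r} − c_{l_r})²`.  For the path the cosine of chapter AG file 1 solves the vertex equations; for the star the two-value
vector of file 3 (to come) does; for a general connected swap graph the positive ground state of `Q` is the conjectured statistic (`Θ((1/ρ_G)·log K)`, OPEN-MATH GEN-47 (iv)).  No definitions.

* §1 **`ptGraphSwap_const_eq_proposal_of_ne`** (every swap accepted on any list with distinct endpoints), **`graphScheme_sum_mul`** (the one-step action on any test function).
* §2 `oneLevelFin_edgeSwap` (the hot-redraw identities are chapter AG file 2's `oneLevel_update_zero` ∕ `oneLevel_redraw`, read off for `Fin`-indexed weights), **`graphScheme_apply_oneLevel`** (`PΦ = Φ + (t/m)Σ_r(c_{i_r} − c_{l_r})(a(x_{l_r}) − a(x_{i_r})) − (1−t)w_0c_0a(x_0)`).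
* §3 `edgeTerm_as_vertex_sum`, **`graphScheme_oneLevel_eigen`** (the vertex equations ⇒ `PΦ = (1−ρ)Φ`), **`graphScheme_oneLevel_increment_le`**.

Literature grade (cell rule): ELEMENTARY, NEW TYPING; nothing cited; no new bib keys.
-/

noncomputable section

open Finset Function
open Literature.Probability.MarkovChains

namespace Summit.Ventures.LatticeQCDFlow.Scaling

variable {S : Type*} [Fintype S] [DecidableEq S] {K m : ℕ} {ν : S → ℝ} {M : Fin (K + 1) → S → S → ℝ} {w : Fin (K + 1) → ℝ} {t : ℝ}

section Graph
variable (e : Fin m → Fin (K + 1) × Fin (K + 1))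

/-! ## §1 Every swap is accepted; the one-step action -/

/-- **EVERY SWAP IS ACCEPTED on any list with distinct endpoints:** with one positive law at every level and identity maps the Metropolis graph swap IS its proposal (`m ≥ 1`). [ours] -/
theorem ptGraphSwap_const_eq_proposal_of_ne (hm : 1 ≤ m) (he : ∀ r, (e r).1 ≠ (e r).2) (hν : ∀ v, 0 < ν v) (y z : Fin (K + 1) → S) :
    ptGraphSwap (fun _ : Fin (K + 1) => ν) e (fun _ => Equiv.refl S) y z = ptGraphProposal e (fun _ => Equiv.refl S) y z := by
  have hμ : ∀ (k : Fin (K + 1)) (v : S), 0 < (fun _ : Fin (K + 1) => ν) k v := fun _ v => hν v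
  have hπ := tensorFun_pos hμ
  have hT : IsRowStochastic (ptGraphProposal e (fun _ => Equiv.refl S)) := ⟨ptGraphProposal_nonneg _ _, sum_ptGraphProposal_eq_one hm _ _⟩
  refine eq_of_offDiag_eq (ptGraphSwap_isRowStochastic hμ) hT (fun y z hzy => ?_) y z
  have h := tensorFun_mul_ptGraphSwap (e := e) (φ := fun _ => Equiv.refl S) hμ he hzy
  by_cases hTz : ptGraphProposal e (fun _ => Equiv.refl S) y z = 0
  · rw [hTz]
    have h0 := mhKernel_le_of_ne (ptGraphProposal e (fun _ => Equiv.refl S)) (tensorFun (fun _ : Fin (K + 1) => ν)) (Ne.symm hzy)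
    rw [hTz] at h0
    exact le_antisymm h0 ((ptGraphSwap_isRowStochastic hμ).1 y z)
  · have hex : ∃ r : Fin m, z = edgeFlowSwap (Equiv.refl S) (e r).1 (e r).2 y := by
      by_contra hne
      apply hTz
      unfold ptGraphProposal
      exact sum_eq_zero fun r _ => if_neg fun h' => hne ⟨r, h'⟩
    obtain ⟨r, hr⟩ := hex
    have hπeq : tensorFun (fun _ : Fin (K + 1) => ν) z = tensorFun (fun _ : Fin (K + 1) => ν) y := by
      rw [hr, edgeFlowSwap_one (he r), tensorFun_const_swap]
    rw [hπeq, min_self, mul_comm] at h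
    exact mul_right_cancel₀ (hπ y).ne' h

variable {P : (Fin (K + 1) → S) → (Fin (K + 1) → S) → ℝ}

/-- **THE ONE-STEP ACTION ON ANY TEST FUNCTION:** `Σ_yP(x,y)G(y) = (t/m)Σ_rG(sw_rx) + (1−t)(w_0Σ_vν(v)G(x[0↦v]) + (1−w_0)G(x))`. [ours] -/
theorem graphScheme_sum_mul (hm : 1 ≤ m) (he : ∀ r, (e r).1 ≠ (e r).2) (hν : ∀ v, 0 < ν v)
    (hM0 : ∀ u v, M 0 u v = ν v) (hidle : ∀ i : Fin K, ∀ u v, M i.succ u v = if v = u then 1 else 0) (hw1 : ∑ k, w k = 1)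
    (hP : ∀ x y, P x y = t * ptGraphSwap (fun _ : Fin (K + 1) => ν) e (fun _ => Equiv.refl S) x y + (1 - t) * prodKernel w M x y)
    (x : Fin (K + 1) → S) (G : (Fin (K + 1) → S) → ℝ) :
    ∑ y, P x y * G y = t / m * ∑ r : Fin m, G (edgeFlowSwap (Equiv.refl S) (e r).1 (e r).2 x) + (1 - t) * (w 0 * ∑ v, ν v * G (update x 0 v) + (1 - w 0) * G x) := by
  have hsw : ∑ y, ptGraphSwap (fun _ : Fin (K + 1) => ν) e (fun _ => Equiv.refl S) x y * G y = 1 / m * ∑ r : Fin m, G (edgeFlowSwap (Equiv.refl S) (e r).1 (e r).2 x) := by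
    simp_rw [ptGraphSwap_const_eq_proposal_of_ne e hm he hν]
    unfold ptGraphProposal
    simp_rw [sum_mul]
    rw [sum_comm, mul_sum]
    refine sum_congr rfl fun r _ => ?_
    simp_rw [ite_mul, zero_mul]
    rw [sum_ite_eq' univ (edgeFlowSwap (Equiv.refl S) (e r).1 (e r).2 x), if_pos (mem_univ _)]
  have hup : ∑ y, prodKernel w M x y * G y = w 0 * ∑ v, ν v * G (update x 0 v) + (1 - w 0) * G x := by
    rw [sum_prodKernel_mul, Fin.sum_univ_succ]
    congr 1
    · simp_rw [hM0]
    · have hi : ∀ i : Fin K, ∑ v, M i.succ (x i.succ) v * G (update x i.succ v) = G x := by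
        intro i
        simp_rw [hidle i, ite_mul, one_mul, zero_mul]
        rw [sum_ite_eq' univ (x i.succ), if_pos (mem_univ _), update_eq_self]
      simp_rw [hi]
      rw [← sum_mul]
      congr 1
      have := hw1
      rw [Fin.sum_univ_succ] at this
      linarith
  simp_rw [hP, add_mul, sum_add_distrib, mul_assoc, ← mul_sum, hsw, hup]
  have hmpos : (0 : ℝ) < m := Nat.cast_pos.mpr (by omega)
  field_simp

/-! ## §2 One-level sums -/

variable {c : Fin (K + 1) → ℝ} {a : S → ℝ} {Φ : (Fin (K + 1) → S) → ℝ}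

omit [Fintype S] [DecidableEq S] in
/-- **A swap of the levels `i ≠ l` on a one-level sum:** `Φ(x∘(i l)) = Φ(x) + (c_i − c_l)(a(x_l) − a(x_i))`. [ours] -/
theorem oneLevelFin_edgeSwap (hΦ : ∀ x, Φ x = ∑ k : Fin (K + 1), c k * a (x k)) {i l : Fin (K + 1)} (hil : i ≠ l) (x : Fin (K + 1) → S) :
    Φ (edgeFlowSwap (Equiv.refl S) i l x) = Φ x + (c i - c l) * (a (x l) - a (x i)) := by
  rw [edgeFlowSwap_one hil, hΦ, hΦ]
  have h1 : ∑ k : Fin (K + 1), c k * a ((x ∘ Equiv.swap i l) k) = ∑ k : Fin (K + 1), c (Equiv.swap i l k) * a (x k) := by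
    have := Equiv.sum_comp (Equiv.swap i l) (fun k : Fin (K + 1) => c (Equiv.swap i l k) * a (x k))
    simp only [Function.comp_apply] at this ⊢
    rw [← this]
    exact sum_congr rfl fun k _ => by rw [Equiv.swap_apply_self]
  rw [h1, ← sub_eq_iff_eq_add', ← sum_sub_distrib]
  have h2 : ∀ k : Fin (K + 1), c (Equiv.swap i l k) * a (x k) - c k * a (x k) = (c (Equiv.swap i l k) - c k) * a (x k) := fun k => by ring
  simp_rw [h2]
  rw [Fintype.sum_eq_add i l hil]
  · rw [Equiv.swap_apply_left, Equiv.swap_apply_right]; ring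
  · intro k hk; rw [Equiv.swap_apply_of_ne_of_ne hk.1 hk.2, sub_self, zero_mul]

omit [DecidableEq S] in
/-- The hot-redraw identities for `Fin`-indexed weights, read off from chapter AG file 2 (`oneLevel_update_zero`,
`oneLevel_redraw`, stated there for `ℕ`-indexed weights): `Φ(x[0↦v]) = Φ(x) + c_0(a(v) − a(x_0))` and, for `Σν = 1`, `Σνa = 0`,
`Σ_vν(v)Φ(x[0↦v]) = Φ(x) − c_0a(x_0)`. [ours] -/
private theorem oneLevelFin_hot (hΦ : ∀ x, Φ x = ∑ k : Fin (K + 1), c k * a (x k)) :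
    (∀ x v, Φ (update x 0 v) = Φ x + c 0 * (a v - a (x 0))) ∧
      (∑ v, ν v = 1 → ∑ v, ν v * a v = 0 → ∀ x, ∑ v, ν v * Φ (update x 0 v) = Φ x - c 0 * a (x 0)) := by
  obtain ⟨c', hc'⟩ : ∃ c' : ℕ → ℝ, ∀ k : Fin (K + 1), c' k = c k :=
    ⟨fun n => if h : n < K + 1 then c ⟨n, h⟩ else 0, fun k => by simp only [dif_pos k.2, Fin.eta]⟩
  have hΦ' : ∀ x, Φ x = ∑ k : Fin (K + 1), c' k * a (x k) := fun x => (hΦ x).trans (sum_congr rfl fun k _ => by rw [hc'])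
  have h0 : c' 0 = c 0 := by simpa only [Fin.val_zero] using hc' 0
  exact ⟨fun x v => by rw [oneLevel_update_zero hΦ' x v, h0], fun hν1 ha0 x => by rw [oneLevel_redraw hν1 ha0 hΦ' x, h0]⟩

/-- **THE SCHEME ACTS ON ONE-LEVEL SUMS BY `I − (t/m)L_G − (1−t)w_0·e_0e_0ᵀ`:**
`Σ_yP(x,y)Φ(y) = Φ(x) + (t/m)Σ_r(c_{i_r} − c_{l_r})(a(x_{l_r}) − a(x_{i_r})) − (1−t)w_0c_0a(x_0)`. [ours] -/
theorem graphScheme_apply_oneLevel (hm : 1 ≤ m) (he : ∀ r, (e r).1 ≠ (e r).2) (hν : ∀ v, 0 < ν v) (hν1 : ∑ v, ν v = 1)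
    (hM0 : ∀ u v, M 0 u v = ν v) (hidle : ∀ i : Fin K, ∀ u v, M i.succ u v = if v = u then 1 else 0) (hw1 : ∑ k, w k = 1)
    (hP : ∀ x y, P x y = t * ptGraphSwap (fun _ : Fin (K + 1) => ν) e (fun _ => Equiv.refl S) x y + (1 - t) * prodKernel w M x y)
    (ha0 : ∑ v, ν v * a v = 0) (hΦ : ∀ x, Φ x = ∑ k : Fin (K + 1), c k * a (x k)) (x : Fin (K + 1) → S) :
    ∑ y, P x y * Φ y = Φ x + t / m * ∑ r : Fin m, (c (e r).1 - c (e r).2) * (a (x (e r).2) - a (x (e r).1)) - (1 - t) * w 0 * (c 0 * a (x 0)) := by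
  have hmpos : (0 : ℝ) < m := Nat.cast_pos.mpr (by omega)
  rw [graphScheme_sum_mul e hm he hν hM0 hidle hw1 hP x Φ, (oneLevelFin_hot hΦ).2 hν1 ha0 x]
  simp_rw [oneLevelFin_edgeSwap hΦ (he _) x]
  rw [sum_add_distrib, sum_const, card_univ, Fintype.card_fin, nsmul_eq_mul]
  field_simp
  ring

/-! ## §3 The vertex equations give an exact eigenfunction; Wilson's increments -/

omit [Fintype S] [DecidableEq S] in
/-- An edge term as a vertex sum: `(c_i − c_l)(a(x_l) − a(x_i)) = Σ_k[1{k=i}(c_l − c_i) + 1{k=l}(c_i − c_l)]·a(x_k)`. [ours] -/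
theorem edgeTerm_as_vertex_sum (c : Fin (K + 1) → ℝ) (a : S → ℝ) (x : Fin (K + 1) → S) (i l : Fin (K + 1)) :
    (c i - c l) * (a (x l) - a (x i)) = ∑ k : Fin (K + 1), ((if k = i then c l - c i else 0) + (if k = l then c i - c l else 0)) * a (x k) := by
  simp_rw [add_mul, sum_add_distrib, ite_mul, zero_mul]
  rw [sum_ite_eq' univ i, sum_ite_eq' univ l, if_pos (mem_univ _), if_pos (mem_univ _)]
  ring

/-- **AN EXACT EIGENFUNCTION FROM THE VERTEX EQUATIONS:** if
`(t/m)·Σ_r[1{k=i_r}(c_{l_r} − c_{i_r}) + 1{k=l_r}(c_{i_r} − c_{l_r})] − 1{k=0}(1−t)w_0c_0 = −ρ·c_k` for every level `k`, then **`Σ_yP(x,y)Φ(y) = (1−ρ)Φ(x)`** for every `x`. [ours] -/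
theorem graphScheme_oneLevel_eigen (hm : 1 ≤ m) (he : ∀ r, (e r).1 ≠ (e r).2) (hν : ∀ v, 0 < ν v) (hν1 : ∑ v, ν v = 1)
    (hM0 : ∀ u v, M 0 u v = ν v) (hidle : ∀ i : Fin K, ∀ u v, M i.succ u v = if v = u then 1 else 0) (hw1 : ∑ k, w k = 1)
    (hP : ∀ x y, P x y = t * ptGraphSwap (fun _ : Fin (K + 1) => ν) e (fun _ => Equiv.refl S) x y + (1 - t) * prodKernel w M x y)
    (ha0 : ∑ v, ν v * a v = 0) (hΦ : ∀ x, Φ x = ∑ k : Fin (K + 1), c k * a (x k)) {ρ : ℝ}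
    (hvertex : ∀ k : Fin (K + 1), t / m * ∑ r : Fin m, ((if k = (e r).1 then c (e r).2 - c (e r).1 else 0) + (if k = (e r).2 then c (e r).1 - c (e r).2 else 0))
      - (if k = 0 then (1 - t) * w 0 * c 0 else 0) = -ρ * c k) (x : Fin (K + 1) → S) :
    ∑ y, P x y * Φ y = (1 - ρ) * Φ x := by
  rw [graphScheme_apply_oneLevel e hm he hν hν1 hM0 hidle hw1 hP ha0 hΦ x]
  simp_rw [edgeTerm_as_vertex_sum c a x]
  rw [sum_comm]
  have hhot : (1 - t) * w 0 * (c 0 * a (x 0)) = ∑ k : Fin (K + 1), (if k = 0 then (1 - t) * w 0 * c 0 else 0) * a (x k) := by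
    simp_rw [ite_mul, zero_mul]
    rw [sum_ite_eq' univ (0 : Fin (K + 1)), if_pos (mem_univ _)]; ring
  rw [hhot]
  have hsum : t / m * ∑ k : Fin (K + 1), ∑ r : Fin m, ((if k = (e r).1 then c (e r).2 - c (e r).1 else 0) + (if k = (e r).2 then c (e r).1 - c (e r).2 else 0)) * a (x k)
      - ∑ k : Fin (K + 1), (if k = 0 then (1 - t) * w 0 * c 0 else 0) * a (x k) + ρ * Φ x
      = ∑ k : Fin (K + 1), (t / m * ∑ r : Fin m, ((if k = (e r).1 then c (e r).2 - c (e r).1 else 0) + (if k = (e r).2 then c (e r).1 - c (e r).2 else 0))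
          - (if k = 0 then (1 - t) * w 0 * c 0 else 0) + ρ * c k) * a (x k) := by
    rw [hΦ x, mul_sum, mul_sum, ← sum_sub_distrib, ← sum_add_distrib]
    refine sum_congr rfl fun k _ => ?_
    rw [← sum_mul]; ring
  have hzero : t / m * ∑ k : Fin (K + 1), ∑ r : Fin m, ((if k = (e r).1 then c (e r).2 - c (e r).1 else 0) + (if k = (e r).2 then c (e r).1 - c (e r).2 else 0)) * a (x k)
      - ∑ k : Fin (K + 1), (if k = 0 then (1 - t) * w 0 * c 0 else 0) * a (x k) + ρ * Φ x = 0 := by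
    rw [hsum]
    exact sum_eq_zero fun k _ => by rw [hvertex k]; ring
  linarith

/-- **WILSON'S INCREMENTS:** `(c_{i_r} − c_{l_r})² ≤ Δ` for every listed pair and `(a(v) − a(v'))² ≤ 1` ⇒ **`Σ_yP(x,y)(Φ(y) − Φ(x))² ≤ tΔ + (1−t)w_0c_0²`** (`0 ≤ t ≤ 1`, `w_0 ≥ 0`). [ours] -/
theorem graphScheme_oneLevel_increment_le (hm : 1 ≤ m) (he : ∀ r, (e r).1 ≠ (e r).2) (hν : ∀ v, 0 < ν v) (hν1 : ∑ v, ν v = 1)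
    (hM0 : ∀ u v, M 0 u v = ν v) (hidle : ∀ i : Fin K, ∀ u v, M i.succ u v = if v = u then 1 else 0)
    (hw0 : 0 ≤ w 0) (hw1 : ∑ k, w k = 1) (ht0 : 0 ≤ t) (ht1 : t ≤ 1)
    (hP : ∀ x y, P x y = t * ptGraphSwap (fun _ : Fin (K + 1) => ν) e (fun _ => Equiv.refl S) x y + (1 - t) * prodKernel w M x y)
    (hΦ : ∀ x, Φ x = ∑ k : Fin (K + 1), c k * a (x k)) {Δ : ℝ} (hΔ : ∀ r : Fin m, (c (e r).1 - c (e r).2) ^ 2 ≤ Δ)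
    (ha : ∀ v v', (a v - a v') ^ 2 ≤ 1) (x : Fin (K + 1) → S) :
    ∑ y, P x y * (Φ y - Φ x) ^ 2 ≤ t * Δ + (1 - t) * w 0 * c 0 ^ 2 := by
  have hmpos : (0 : ℝ) < m := Nat.cast_pos.mpr (by omega)
  rw [graphScheme_sum_mul e hm he hν hM0 hidle hw1 hP x (fun y => (Φ y - Φ x) ^ 2)]
  simp only [sub_self]
  have hΔ0 : 0 ≤ Δ := le_trans (sq_nonneg _) (hΔ ⟨0, by omega⟩)
  have hsw : ∑ r : Fin m, (Φ (edgeFlowSwap (Equiv.refl S) (e r).1 (e r).2 x) - Φ x) ^ 2 ≤ m * Δ := by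
    have hr : ∀ r : Fin m, (Φ (edgeFlowSwap (Equiv.refl S) (e r).1 (e r).2 x) - Φ x) ^ 2 ≤ Δ := by
      intro r
      rw [oneLevelFin_edgeSwap hΦ (he r) x, add_sub_cancel_left, mul_pow]
      calc (c (e r).1 - c (e r).2) ^ 2 * (a (x (e r).2) - a (x (e r).1)) ^ 2 ≤ Δ * 1 := mul_le_mul (hΔ r) (ha _ _) (sq_nonneg _) hΔ0
        _ = Δ := mul_one _
    calc ∑ r : Fin m, (Φ (edgeFlowSwap (Equiv.refl S) (e r).1 (e r).2 x) - Φ x) ^ 2 ≤ ∑ _r : Fin m, Δ := sum_le_sum fun r _ => hr r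
      _ = m * Δ := by rw [sum_const, card_univ, Fintype.card_fin, nsmul_eq_mul]
  have hrd : ∑ v, ν v * (Φ (update x 0 v) - Φ x) ^ 2 ≤ c 0 ^ 2 := by
    have hv : ∀ v, ν v * (Φ (update x 0 v) - Φ x) ^ 2 ≤ ν v * c 0 ^ 2 := by
      intro v
      rw [(oneLevelFin_hot (ν := ν) hΦ).1 x v, add_sub_cancel_left, mul_pow]
      refine mul_le_mul_of_nonneg_left ?_ (hν v).le
      calc c 0 ^ 2 * (a v - a (x 0)) ^ 2 ≤ c 0 ^ 2 * 1 := mul_le_mul_of_nonneg_left (ha v (x 0)) (sq_nonneg _)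
        _ = c 0 ^ 2 := mul_one _
    calc ∑ v, ν v * (Φ (update x 0 v) - Φ x) ^ 2 ≤ ∑ v, ν v * c 0 ^ 2 := sum_le_sum fun v _ => hv v
      _ = c 0 ^ 2 := by rw [← sum_mul, hν1, one_mul]
  have e0 : ((0 : ℝ)) ^ 2 = 0 := by norm_num
  rw [e0, mul_zero, add_zero]
  have h1 : t / m * ∑ r : Fin m, (Φ (edgeFlowSwap (Equiv.refl S) (e r).1 (e r).2 x) - Φ x) ^ 2 ≤ t * Δ := by
    calc t / m * ∑ r : Fin m, (Φ (edgeFlowSwap (Equiv.refl S) (e r).1 (e r).2 x) - Φ x) ^ 2 ≤ t / m * (m * Δ) := mul_le_mul_of_nonneg_left hsw (by positivity)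
      _ = t * Δ := by field_simp
  have h2 : (1 - t) * (w 0 * ∑ v, ν v * (Φ (update x 0 v) - Φ x) ^ 2) ≤ (1 - t) * w 0 * c 0 ^ 2 := by
    rw [mul_assoc]; exact mul_le_mul_of_nonneg_left (mul_le_mul_of_nonneg_left hrd hw0) (by linarith)
  linarith

end Graph

end Summit.Ventures.LatticeQCDFlow.Scaling

end
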